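import Summits.QuantumFields.YangMills.Theorems.BalabanUVNodesPortS1JacobianHoloDefs
import Summits.QuantumFields.YangMills.Theorems.BalabanUVNodesK0RecordFormatNamesIntLocalW
import Literature.MathematicalPhysics.QuantumFieldTheory.Balaban1983to89.Node00.TorusCoverBlockAveragingZd

/-!
# NODE O port PT-A — OBJECTS OF ROW (e) OF `stub_LZjac` («the integer-lattice packaging», PORT-PLAN-v5 §4).  TORUS SIDE (§1–§2): the WINDOW-LOCAL holomorphic `b₀`-block in
# TRACE-PROJECTED coordinates, the torus Jacobian functional `J_T(c, 𝐔) := log det A₁^ℂ(c)(Ū^k 𝐔)` of a complex fine-lattice configuration, the localization domain `X(c)` of a coarse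
# bond, the TORUS PIECES `E_T(X, φ) := −Σ_{c : X(c) = X} [J_T(c, 𝐔) − J_T(c, 1)]`.  INTEGER SIDE (§3–§6): the (0.4) block averaging ON THE UNIVERSAL COVER `ℤ^d`, the window-restricted
# derivative block, `J_ℤ(ĉ, 𝐔)`, and THE INTEGER FORMULA `Ψ_jac(X̂, f) := −Σ_{ĉ : cubes(ĉ) = X̂} [J_ℤ(ĉ, f.1) − J_ℤ(ĉ, 1)]` of the δ-Jacobian bracket

Cell `ym-nodeO-ideate`, porter seat `ymgap-nodeO-port-PTA-1` (gen 6); DEFINITION file (objects the line posits for `stub_LZjac` of 27930's skeleton `pta_residueW`, PORT-PLAN-v5 §4 row (e)),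
`--supports stmt-QuantumFields-27930`.  [I] = [Balaban1987RG1], [15] = [Balaban1985Variational].

WHY (torus side).  `phiLZjac n B = −Σ_c [log|det A₁(c)(V^{(k)}_{ax}(W_B))| − (same at B = 0)]` (✓ `…HalvesJacDefs`) must be REPRESENTED ((f′)-W of `IntLocalFormula.ResidueAtW`) by ONE window-local
`SL(2,ℂ)`-invariant integer formula off the centred wrap class plus free torus pieces on it.  Two located adjustments of gen 5's holomorphic block `jacBlockC` (✓ `…JacobianHoloDefs`) make
the torus functional UNCONDITIONALLY local and gauge covariant (as total functions, junk values included — which is what `IntFormula.IsLocal ∕ IsGaugeInv` demand):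
(1) the derivative of the (0.4) average is taken COMPONENTWISE, `fderiv ℂ (fun W ↦ avgMh W c) W`, not as the `c`-component of the derivative of the whole map `W ↦ avgMh W` (the latter is
`0` as soon as `avgMh` fails to be differentiable at ANY coarse bond of the torus — a non-local junk value; the two agree wherever `avgMh` is differentiable, in particular on the germ of
✓ `…JacobianGerm`); (2) the 𝔰𝔲(2)-coordinates are read after the TRACE PROJECTION `M ↦ M − ½(tr M)·1` (`su2CoordCt`; equal to `su2CoordC` on traceless arguments, which the response is
at `SL(2,ℂ)`-valued fields in the polydisc, ✓ `…JacobianHoloSL2.trace_jacResponse_eq_zero`), so that the block law `A₁^ℂ(c)(W^u) = Ad^ℂ(u(c₋)) · A₁^ℂ(c)(W) · Ad^ℂ(u(b₀(c)₋))⁻¹` holds for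
EVERY `W` and every det-one `u` (companion proof files).  The background `V^{(k)}_{ax}(W_B) = axialize(Ū^k(U_{k+1}(W_B)))` (✓ `…PathLetter`) enters through the HOLOMORPHIC ITERATE `iterMh k`
of the tree's model (✓ `B15AveragingHolomorphic`); `axialize` is a gauge transformation (`BlockAxialRepresentative.axialize_def`) and drops out by invariance.
* `su2CoordCt`, `jacBlockCt c W`, `jacFactorCt c W := log det`, `jacTorus k c 𝐔 := jacFactorCt c (iterMh k 𝐔)` — generic over the torus `P`.
* at the record torus `F.P K`: `cubeOfSite` (the `Mc`-cube of a level-`(k+1)` site), `domOfBond c = X(c)` (the one or two wall-adjacent `Mc`-cubes of `𝐃_{k+1}(T_K)` containing `c₋, c₊`),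
  `jacPieceT X φ = E_T(X, φ)`, `jacTorusPieces` (the same at the shifted volumes `recordK₀ F Mc k + n`, in the type `TorusPieces F Mc k` of the wrap-aware residue).

WHY (integer side).  The wrap-aware residue asks, off the centred wrap class, for ONE `IntLocalFormula s` — a function of a finite set `X̂ ⊂ ℤ⁴` of integer cube indices and of an integer-bond
configuration `f`, WINDOW-LOCAL and `SL(2,ℂ)`-GAUGE-INVARIANT as a total function — whose pull-backs through the universal covers `cover_K : ℤ⁴ → T_K` are the pieces at every volume
([I] (1.21) p.264 «T^{(j+1)} ↗ Z^d … exists by the localized representation (1.7)»).  The piece of a coarse bond is a LOCAL function of the fine configuration under the two `(k+1)`-blocks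
of the bond (the `k`-fold (0.4) average, then the response of one more (0.4) average at the central bond), so the integer formula is THE SAME COMPUTATION DONE ON `ℤ^d`: the (0.4) contours
are words (`T4Continuum.loopWord`) walked on `ℤ^d` instead of `T^{(j)}`; blocks are floor division by `L` (`QuantumLattice.blockMap L`), block centres `embZ`; every identity
`opZ (𝐕 ∘ cover) = op 𝐕 ∘ cover` then holds GLOBALLY (companion bridge file), because the cover is a homomorphism intertwining `+e_μ`, `blockOf` and `emb`.  The only finite-dimensional
ingredient — the derivative — is taken on the finite WINDOW of the coarse bond (`winBondsZ`) through the restriction ∕ extension pair (`restrictZ`, `extendZ`).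
* §3 the integer lattice (REUSING the tree's `ℤ^d` vocabulary: unit vectors `B7Prop1Explicit.e`, index set ∕ offsets `BlockAveragingZd.IdxZ ∕ offZ` = `BlockAveraging.Idx ∕ off` by `rfl`,
  the level covers `Node00.coverAt P j : ℤ^d → T^{(j)}` of `Node00.TorusCoverLevels`, blocks `QuantumLattice.blockMap ∕ blockSites`): `walkZ` (walks as step lists), `embZ`, `centralBondZ`,
  `coverBondAt`, `coverStepAt`.
* §4 the holomorphic (0.4) model on `ℤ^d`: `stepMhZ ∕ holMhZ ∕ loopMhZ ∕ axialMhZ ∕ corrMhZ ∕ avgMhZ ∕ iterMhZ` (verbatim twins of `B15AveragingHolomorphic`'s torus objects).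
* §5 the window of an integer coarse bond and the derivative block: `winSitesZ ∕ winBondsZ`, `extendZ ∕ restrictZ`, `avgMhZW`, `jacBlockZ ĉ 𝐕`, `jacFactorZ := log det`,
  `jacZ L k ĉ 𝐔 := jacFactorZ ĉ (iterMhZ k 𝐔)`.
* §6 THE FORMULA: `cubesetZ Mc ĉ` (the `Mc`-cubes of `ĉ₋, ĉ₊`), `coarseBondsOf Mc X̂` (the integer coarse bonds whose cube set is `X̂`), ★★★ `ΨjacRaw F Mc k : IntFormula`.  Its (LOC)∕(GI)
  structure fields (`IntLocalFormula`), the cover bridge `jacZ k ĉ (𝐔 ∘ cover) = jacTorus k (cover ĉ) 𝐔` and the representation of `phiLZjac` are the companion proof files.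

HONEST FRAMING.  Definitions only; NOTHING of Bałaban asserted or proved; `stub_LZjac` OPEN (rows (a)(b) on the (1.11)–(1.16) domain are porter PTZ-1's item; the cover bridge, (LOC)∕(GI)
and the representation are the companion files of this generation); 27930 OPEN · no claim; K0⁷∕K-Ax OPEN; NODE O 0∕1; COUNT 8∕28 · K 1∕4 UNMOVED; finite `𝕋⁴_{L^K}` at fixed ε — NOT
continuum ∕ OS ∕ Clay; **the Yang–Mills mass gap is NOT proved by any of this.**  No `sorry`, no `instance`, no `notation`; standard axioms.
-/

noncomputable section

open scoped BigOperators Matrix.Norms.L2Operator Topology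

namespace Summit.QuantumFields.YangMills.Theorems.BalabanUVNodesPortS1

open Summit.QuantumFields.YangMills.Theorems.K0RecordFormatNames
open Literature.MathematicalPhysics.QuantumFieldTheory.Balaban1983to89
open Literature.MathematicalPhysics.QuantumFieldTheory.Balaban1983to89.Node00
open Literature.MathematicalPhysics.QuantumFieldTheory.Balaban1983to89.T4Continuum (T4Family Letter LStep loopWord)
open Literature.MathematicalPhysics.QuantumFieldTheory.Balaban1983to89.BlockAveragingHaarAC (centralBond)
open Literature.MathematicalPhysics.QuantumFieldTheory.Balaban1983to89.B15AveragingHolomorphic (avgMh iterMh)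
open Literature.MathematicalPhysics.QuantumFieldTheory.Balaban1983to89.TreeLengthTorus (TPt IsTDom)
open Literature.MathematicalPhysics.QuantumFieldTheory.Balaban1983to89.ExpMeanLog (eml)
open Literature.MathematicalPhysics.QuantumFieldTheory.Balaban1983to89.B7Prop1Explicit (e)
open Literature.MathematicalPhysics.QuantumFieldTheory.Balaban1983to89.BlockAveragingZd (IdxZ offZ)
open Literature.MathematicalPhysics.QuantumLattice (blockMap blockSites)
open _root_.Matrix

/-! ## §1  The window-local holomorphic block in trace-projected coordinates, its Jacobian factor, the torus Jacobian functional (generic torus `P`) -/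

section Torus

variable {P : Params} {j : ℕ}

/-- **Trace-projected complex coordinates against `su2Gen`**: `su2CoordCt M := su2CoordC (M − ½(tr M)·1) = (−i(M₀₁+M₁₀)∕2, (M₀₁−M₁₀)∕2, −i(M₀₀−M₁₁)∕2)`; on traceless `M` it is
`su2CoordC M`, and it kills `1` (so the coordinate reading commutes with conjugation on ALL of `M₂(ℂ)`). [cite: Balaban1987RG1, (1.10) p.262 («𝔤ᶜ»), (2.4) p.266 (bookkeeping)] -/
def su2CoordCt (M : MatA 2) : Fin 3 → ℂ :=
  ![-Complex.I * (M 0 1 + M 1 0) / 2, (M 0 1 - M 1 0) / 2, -Complex.I * (M 0 0 - M 1 1) / 2]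

/-- ★ **THE WINDOW-LOCAL HOLOMORPHIC `b₀`-BLOCK `A₁^ℂ(c)(W)`** of a level-`j` matrix field at the coarse bond `c`: the trace-projected `su2Gen`-coordinates of the COMPONENTWISE derivative of the
holomorphic (0.4) average at `c`, in the tangent direction `su2Gen a · W(b₀(c))` on the central bond, times `(avgMh W c)⁻¹`.  Equal to gen 5's `jacBlockC c W` wherever `avgMh` is
ℂ-differentiable at `W` and the response is traceless (the germ ∕ the (1.11)–(1.16) domain); unconditionally LOCAL (reads `W` on the bonds of `B(c₋) ∪ B(c₊)` only) and gauge COVARIANT.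
[cite: Balaban1987RG1, p.267 («h(c)»), (0.4) p.253, (2.16) p.269; Balaban1985Variational, Prop. 9 p.309] -/
def jacBlockCt (c : PBond P (j + 1)) (W : PBond P j → MatA 2) : Matrix (Fin 3) (Fin 3) ℂ :=
  Matrix.of fun i a => su2CoordCt (fderiv ℂ (fun W' : PBond P j → MatA 2 => avgMh W' c) W
    (Pi.single (centralBond c) (su2Gen a * W (centralBond c))) * (avgMh W c)⁻¹) i

/-- ★ **THE WINDOW-LOCAL HOLOMORPHIC JACOBIAN FACTOR** `log det A₁^ℂ(c)(W)` (principal branch). [cite: Balaban1987RG1, p.268 («we eliminate the variables B′(b₀(c))»), (1.18) p.263] -/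
def jacFactorCt (c : PBond P (j + 1)) (W : PBond P j → MatA 2) : ℂ := Complex.log (jacBlockCt c W).det

/-- ★★ **THE TORUS JACOBIAN FUNCTIONAL `J_T(c, 𝐔) := log det A₁^ℂ(c)(Ū^k 𝐔)`** of a complex FINE-lattice configuration `𝐔` (the first component of print's pair `(𝐔, 𝐉)`), through the
holomorphic `k`-fold iterate `iterMh k` of the tree's (0.4) model; at `𝐔 = ↑U_{k+1}(W_B)` near `B = 0` it is the Jacobian factor `log|det A₁(c)(V^{(k)}_{ax}(W_B))|` of `phiLZjac`
(`axialize` is a gauge transformation and drops out — companion proof file). [cite: Balaban1987RG1, p.268, (2.3) p.265, (0.21) p.256; Balaban1985Variational, Prop. 9 p.309] -/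
def jacTorus (k : ℕ) (c : PBond P (k + 1)) (U : PBond P 0 → MatA 2) : ℂ := jacFactorCt c (iterMh k U)

end Torus

/-! ## §2  At the record torus `T_K`: the localization domain `X(c)` of a coarse bond and the torus pieces `E_T(X, φ)` -/

section Record

variable (F : T4Family)

/-- **The `Mc`-cube of `𝐃_{k+1}(T_K)` containing a level-`(k+1)` site** (cube index = coordinates `div Mc`; in the exactly tiled range `recordK₀ F Mc k ≤ K` the level-`(k+1)` torus has
`q · Mc` sites per direction, `q = Sect2.domCount`). [cite: Balaban1987RG1, p.257 (the cubes π_j)] -/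
def cubeOfSite (Mc k K : ℕ) (y : Site (F.P K) (k + 1)) : TPt (F.P K).d (Sect2.domCount (F.P K) Mc (k + 1)) :=
  fun i => (((y i).val / Mc : ℕ) : ZMod (Sect2.domCount (F.P K) Mc (k + 1)))

open scoped Classical in
/-- ★ **`X(c)` — THE LOCALIZATION DOMAIN OF A COARSE BOND**: the one or two `Mc`-cubes of `𝐃_{k+1}(T_K)` containing `c₋` and `c₊` (wall-adjacent in the tiled range, companion proof file;
the `dite` default is never read there).  The Jacobian factor of `c` reads the configuration on the two `(k+1)`-blocks `B^{k+1}(c₋) ∪ B^{k+1}(c₊) ⊆ X(c)` only, so it is the piece of `X(c)`.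
[cite: Balaban1987RG1, (1.7) p.261, p.257, p.267–268] -/
def domOfBond (Mc k K : ℕ) (c : PBond (F.P K) (k + 1)) : (recordDomSys F Mc k K).Dom :=
  if h : IsTDom ({cubeOfSite F Mc k K c.src, cubeOfSite F Mc k K c.tgt} : Finset (TPt (F.P K).d (Sect2.domCount (F.P K) Mc (k + 1)))) then ⟨_, h⟩
  else Sect2.cubeDom (F.P K) Mc (k + 1) (cubeOfSite F Mc k K c.src)

open scoped Classical in
/-- ★★ **THE TORUS PIECES `E_T(X, φ) := −Σ_{c : X(c) = X} [J_T(c, 𝐔) − J_T(c, 1)]`** of the δ-Jacobian bracket at volume `K` (functions of the pair `φ = (𝐔, 𝐉)` on the torus; the current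
`𝐉` is not read).  On the centred wrap class these ARE the free pieces `Ew` of the wrap-aware residue; off it they are the torus reading of the integer formula (companion files).
[cite: Balaban1987RG1, (1.6)–(1.7) p.261, p.268] -/
def jacPieceT (Mc k K : ℕ) (X : (recordDomSys F Mc k K).Dom) (φ : Sect2.CPair (F.P K) (MatA 2)) : ℂ :=
  -∑ c ∈ Finset.univ.filter (fun c : PBond (F.P K) (k + 1) => domOfBond F Mc k K c = X), (jacTorus k c φ.1 - jacTorus k c 1)

/-- **The torus pieces at the shifted volumes `recordK₀ F Mc k + n`**, in the type `TorusPieces F Mc k` of `IntLocalFormula.ResidueAtW` (the `Ew` slot). [cite: Balaban1987RG1, (1.7) p.261, (1.21) p.264] -/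
def jacTorusPieces (Mc k : ℕ) : TorusPieces F Mc k := fun n X φ => jacPieceT F Mc k (recordK₀ F Mc k + n) X φ

end Record

/-! ## §3  The integer lattice `ℤ^d` (vocabulary of `B7Prop1Explicit` ∕ `BlockAveragingZd` ∕ `Node00.TorusCoverLevels`): walks as step lists, block centres, the central bond, the cover on bonds -/

section Lattice

variable {d : ℕ}

/-- **The walk on `ℤ^d` spelled by a word, as a list of oriented steps** (integer bond, orientation) — the twin of `T4Continuum.walk`: `+e_μ` from `x` traverses `(x, μ)` forward
and moves to `x + e_μ`; `−e_μ` traverses `(x − e_μ, μ)` backward and moves to `x − e_μ` (`e = B7Prop1Explicit.e`). [cite: Balaban1987RG1, (0.3)–(0.4) pp.252–253] -/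
def walkZ : (Fin d → ℤ) → List (Letter d) → List (((Fin d → ℤ) × Fin d) × Bool)
  | _, [] => []
  | x, (μ, true) :: w => ((x, μ), true) :: walkZ (x + e μ) w
  | x, (μ, false) :: w => ((x - e μ, μ), false) :: walkZ (x - e μ) w

/-- **The block centre on `ℤ^d`**: `embZ L y = L·y + (L−1)∕2` coordinatewise (the twin of `Setup.emb`, B12's centred convention; the right-hand side of
`Node00.emb_coverAt`). [cite: Balaban1987RG1, (0.1) p.252] -/
def embZ (L : ℕ) (y : Fin d → ℤ) : Fin d → ℤ := fun i => (L : ℤ) * y i + (((L - 1) / 2 : ℕ) : ℤ)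

/-- **The central bond `b₀(ĉ)` of an integer coarse bond** `ĉ = (y, μ)`: the bond of the straight line from `embZ L y` to `embZ L (y + e_μ)` crossing the block wall
(longitudinal offset `(L−1)∕2`; the twin of `BlockAveragingHaarAC.centralBond = AveragingRT.line c ((L−1)∕2)`). [cite: Balaban1987RG1, p.267 («h(c)»; bookkeeping)] -/
def centralBondZ (L : ℕ) (ĉ : (Fin d → ℤ) × Fin d) : (Fin d → ℤ) × Fin d :=
  (Function.update (embZ L ĉ.1) ĉ.2 (embZ L ĉ.1 ĉ.2 + (((L - 1) / 2 : ℕ) : ℤ)), ĉ.2)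

/-- The level-`j` cover `π_j = Node00.coverAt P j : ℤ^d → T^{(j)}` on bonds. [cite: Balaban1987RG1, (1.21) p.264 (bookkeeping)] -/
def coverBondAt (P : Params) (j : ℕ) (b : (Fin P.d → ℤ) × Fin P.d) : PBond P j := ⟨coverAt P j b.1, b.2⟩

/-- The level-`j` cover on oriented steps. [cite: Balaban1987RG1, (1.21) p.264 (bookkeeping)] -/
def coverStepAt (P : Params) (j : ℕ) (s : ((Fin P.d → ℤ) × Fin P.d) × Bool) : LStep P j := ⟨coverBondAt P j s.1, s.2⟩

end Lattice

/-! ## §4  The holomorphic (0.4) block averaging on `ℤ^d` (twins of `B15AveragingHolomorphic.stepMh ∕ holMh ∕ loopMh ∕ axialMh ∕ corrMh ∕ avgMh ∕ iterMh`) -/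

section Averaging

variable {d : ℕ}

/-- The holomorphic step matrix on `ℤ^d`: `𝐕(b)` forward, `adj 𝐕(b)` backward. [cite: Balaban1987RG1, (0.4) p.253; Balaban1985Variational, p.307] -/
def stepMhZ (V : (Fin d → ℤ) × Fin d → MatA 2) (s : ((Fin d → ℤ) × Fin d) × Bool) : MatA 2 :=
  if s.2 then V s.1 else (V s.1).adjugate

/-- The holomorphic walk product on `ℤ^d` (ordered product of the step matrices of a step list). [cite: Balaban1987RG1, (0.4) p.253] -/
def holMhZ (V : (Fin d → ℤ) × Fin d → MatA 2) (γ : List (((Fin d → ℤ) × Fin d) × Bool)) : MatA 2 := (γ.map (stepMhZ V)).prod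

/-- The (0.4) loop matrices at the integer coarse bond `ĉ = (y, μ)`: walk products along `Γ ∪ [x, x′] ∪ (−Γ′) ∪ (−c)` from `embZ L y` (index set `BlockAveragingZd.IdxZ d L`
`= BlockAveraging.Idx P`, offsets `BlockAveragingZd.offZ = BlockAveraging.off`, by `rfl`). [cite: Balaban1987RG1, (0.4) p.253] -/
def loopMhZ (L : ℕ) (V : (Fin d → ℤ) × Fin d → MatA 2) (ĉ : (Fin d → ℤ) × Fin d) (i : IdxZ d L) : MatA 2 :=
  holMhZ V (walkZ (embZ L ĉ.1) (loopWord L ĉ.2 (offZ L i.1) i.2.1 i.2.2))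

/-- The straight-segment matrix `𝐕([ĉ₋, ĉ₊])` on `ℤ^d`: `L` steps `+e_μ` from `embZ L y`. [cite: Balaban1987RG1, (0.4) p.253; Balaban1984PropagatorsI, (1.7) p.18] -/
def axialMhZ (L : ℕ) (V : (Fin d → ℤ) × Fin d → MatA 2) (ĉ : (Fin d → ℤ) × Fin d) : MatA 2 :=
  holMhZ V (walkZ (embZ L ĉ.1) (List.replicate L (ĉ.2, true)))

/-- The correction factor `exp[|I|⁻¹ Σ_i log 𝐕(loop_i)]` on `ℤ^d` (`ExpMeanLog.eml`). [cite: Balaban1987RG1, (0.4) p.253] -/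
def corrMhZ (L : ℕ) (V : (Fin d → ℤ) × Fin d → MatA 2) (ĉ : (Fin d → ℤ) × Fin d) : MatA 2 :=
  eml fun i : IdxZ d L => loopMhZ L V ĉ i

/-- ★ **THE HOLOMORPHIC (0.4) BLOCK AVERAGING ON `ℤ^d`**: `avgMhZ L 𝐕 ĉ = exp[|I|⁻¹ Σ_i log 𝐕(loop_i)] · 𝐕([ĉ₋, ĉ₊])`. [cite: Balaban1987RG1, (0.4) p.253, (1.21) p.264] -/
def avgMhZ (L : ℕ) (V : (Fin d → ℤ) × Fin d → MatA 2) : (Fin d → ℤ) × Fin d → MatA 2 := fun ĉ => corrMhZ L V ĉ * axialMhZ L V ĉ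

/-- **The `k`-fold iterate on `ℤ^d`** (every level identified with `ℤ^d`; level-`k` bonds `(y, μ)`, `y ∈ ℤ^d`). [cite: Balaban1987RG1, (0.21) p.256] -/
def iterMhZ (L : ℕ) : ℕ → ((Fin d → ℤ) × Fin d → MatA 2) → ((Fin d → ℤ) × Fin d → MatA 2)
  | 0 => id
  | k + 1 => fun V => avgMhZ L (iterMhZ L k V)

end Averaging

/-! ## §5  The window of an integer coarse bond; the window-restricted average and the derivative block -/

section Window

variable {d : ℕ}

/-- The sites of the WINDOW `B(ĉ₋) ∪ B(ĉ₊)` of an integer coarse bond (`QuantumLattice.blockSites L y = {z : ⌊z∕L⌋ = y}`). [cite: Balaban1987RG1, (0.4) p.253 (the contours stay in the two blocks)] -/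
def winSitesZ (L : ℕ) (ĉ : (Fin d → ℤ) × Fin d) : Finset (Fin d → ℤ) :=
  blockSites L ĉ.1 ∪ blockSites L (ĉ.1 + e ĉ.2)

/-- **The WINDOW BONDS of `ĉ`**: integer bonds with both endpoints in `B(ĉ₋) ∪ B(ĉ₊)` — the only bonds the (0.4) average at `ĉ` reads. [cite: Balaban1987RG1, (0.4) p.253, p.267] -/
def winBondsZ (L : ℕ) (ĉ : (Fin d → ℤ) × Fin d) : Finset ((Fin d → ℤ) × Fin d) :=
  (winSitesZ L ĉ ×ˢ (Finset.univ : Finset (Fin d))).filter fun b => b.1 + e b.2 ∈ winSitesZ L ĉ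

/-- Extension of a configuration on a finite bond set by `1` elsewhere. [cite: Balaban1987RG1, (1.7) p.261 (bookkeeping)] -/
def extendZ (S : Finset ((Fin d → ℤ) × Fin d)) (w : ↥S → MatA 2) : (Fin d → ℤ) × Fin d → MatA 2 :=
  fun b => if h : b ∈ S then w ⟨b, h⟩ else 1

/-- Restriction of a configuration to a finite bond set. [cite: Balaban1987RG1, (1.7) p.261 (bookkeeping)] -/
def restrictZ (S : Finset ((Fin d → ℤ) × Fin d)) (V : (Fin d → ℤ) × Fin d → MatA 2) : ↥S → MatA 2 := fun b => V b.1

/-- **The (0.4) average at `ĉ` as a function on the finite-dimensional window space** (configurations on `winBondsZ L ĉ`, extended by `1`). [cite: Balaban1987RG1, (0.4) p.253, p.267] -/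
def avgMhZW (L : ℕ) (ĉ : (Fin d → ℤ) × Fin d) (w : ↥(winBondsZ L ĉ) → MatA 2) : MatA 2 := avgMhZ L (extendZ (winBondsZ L ĉ) w) ĉ

/-- ★ **THE INTEGER `b₀`-BLOCK `A₁^ℤ(ĉ)(𝐕)`**: trace-projected `su2Gen`-coordinates of the derivative of the window-restricted average in the direction `su2Gen a · 𝐕(b₀(ĉ))` on the central bond,
times `(avgMhZ L 𝐕 ĉ)⁻¹` (the twin of `jacBlockCt` on the cover). [cite: Balaban1987RG1, p.267 («h(c)»), (2.16) p.269, (1.21) p.264] -/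
def jacBlockZ (L : ℕ) (ĉ : (Fin d → ℤ) × Fin d) (V : (Fin d → ℤ) × Fin d → MatA 2) : Matrix (Fin 3) (Fin 3) ℂ :=
  Matrix.of fun i a => su2CoordCt (fderiv ℂ (avgMhZW L ĉ) (restrictZ (winBondsZ L ĉ) V)
    (restrictZ (winBondsZ L ĉ) (Pi.single (centralBondZ L ĉ) (su2Gen a * V (centralBondZ L ĉ)))) * (avgMhZ L V ĉ)⁻¹) i

/-- ★ **The integer Jacobian factor** `log det A₁^ℤ(ĉ)(𝐕)`. [cite: Balaban1987RG1, p.268, (1.18) p.263] -/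
def jacFactorZ (L : ℕ) (ĉ : (Fin d → ℤ) × Fin d) (V : (Fin d → ℤ) × Fin d → MatA 2) : ℂ := Complex.log (jacBlockZ L ĉ V).det

/-- ★★ **THE INTEGER JACOBIAN FUNCTIONAL `J_ℤ(ĉ, 𝐔) := log det A₁^ℤ(ĉ)(Ū^k 𝐔)`** of a complex configuration on the fine integer bonds (the pull-back twin of `jacTorus`).
[cite: Balaban1987RG1, p.268, (0.21) p.256, (1.21) p.264] -/
def jacZ (L k : ℕ) (ĉ : (Fin d → ℤ) × Fin d) (U : (Fin d → ℤ) × Fin d → MatA 2) : ℂ := jacFactorZ L ĉ (iterMhZ L k U)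

end Window

/-! ## §6  THE INTEGER FORMULA `Ψ_jac` of the δ-Jacobian bracket -/

section Formula

variable {d : ℕ}

/-- **The `Mc`-cube set of an integer coarse bond** `ĉ = (y, μ)` (level-`(k+1)` sites): the cube indices `⌊y∕Mc⌋`, `⌊(y + e_μ)∕Mc⌋` (one or two wall-adjacent cubes;
`QuantumLattice.blockMap`). [cite: Balaban1987RG1, p.257, (1.7) p.261] -/
def cubesetZ (Mc : ℕ) (ĉ : (Fin d → ℤ) × Fin d) : Finset (Fin d → ℤ) := {blockMap Mc ĉ.1, blockMap Mc (ĉ.1 + e ĉ.2)}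

/-- **The integer coarse bonds belonging to the cube set `X̂`**: those `ĉ` with `cubesetZ Mc ĉ = X̂` (a finite set: `ĉ₋` ranges over the `Mc`-cubes of `X̂`). [cite: Balaban1987RG1, (1.7) p.261, (1.21) p.264] -/
def coarseBondsOf (Mc : ℕ) (Xh : Finset (Fin d → ℤ)) : Finset ((Fin d → ℤ) × Fin d) :=
  ((Xh.biUnion fun a => blockSites Mc a) ×ˢ (Finset.univ : Finset (Fin d))).filter fun ĉ => cubesetZ Mc ĉ = Xh

/-- ★★★ **THE INTEGER FORMULA OF THE δ-JACOBIAN BRACKET**: `Ψ_jac(X̂, f) := −Σ_{ĉ : cubes(ĉ) = X̂} [J_ℤ(ĉ, f.1) − J_ℤ(ĉ, 1)]` at block size `F.L`, cube letter `Mc`, step `k` — ONE formula for every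
volume; its window-locality and `SL(2,ℂ)`-invariance (the `IntLocalFormula` fields) and its cover bridge to the torus pieces `jacPieceT` are the companion proof files.
[cite: Balaban1987RG1, (1.7) p.261, (1.19) p.263, (1.21) p.264, p.268] -/
def ΨjacRaw (F : T4Family) (Mc k : ℕ) : IntFormula := fun Xh f =>
  -∑ ĉ ∈ coarseBondsOf Mc Xh, (jacZ F.L k ĉ (fun b => (f b).1) - jacZ F.L k ĉ 1)

end Formula

end Summit.QuantumFields.YangMills.Theorems.BalabanUVNodesPortS1

end
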